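import Literature.RepresentationTheory.KonnoKonno2007.JunctionHyperbolicFockMatrix
import Literature.Analysis.SegalBargmann.FockLadderAdjoint
import Literature.Analysis.SegalBargmann.SchwartzTensorSchur
import HarnessLib

/-!
# The two-mode squeeze ladder in the Fock model, Hermite-coefficient functionals, and the ladder-diagonal
# entries of a linear substitution (kernel, 0 records)

Topic `RepresentationTheory/KonnoKonno2007`; generic index type `σ` throughout (namespaces
`Literature.Analysis.SegalBargmann` for the pure Fock-model algebra, `Literature.RepresentationTheory.KonnoKonno2007.RealDualPair`
for the two statements about the pair symbol `hypPairSymb` of `JunctionHyperbolicFockMatrix`).  This is the polynomial /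
Hilbert-space algebra behind the squeezed vacuum of the hyperbolic one-parameter family of a real unitary dual-pair
junction (`JunctionSqueezedVacuum`, `JunctionVacuumOverlap`): in Folland's Fock model (Folland 1989, §1.6–§1.7: orthonormal
monomials `ζ_α = √(π^{|α|}/α!) z^α` (1.68), `z_j^* = π⁻¹ ∂_j` Thm (1.63), the Hermite/Fock dictionary Prop (4.39) as landed in
`Literature/Analysis/SegalBargmann/`), for two distinct modes `k ≠ k'` and the step `d := e_k + e_{k'}`:

* §1 THE LADDER `π z_k z_{k'} ζ_γ = √((γ_k+1)(γ_{k'}+1)) ζ_{γ+d}`, `π⁻¹ ∂_k ∂_{k'} ζ_γ = √(γ_k γ_{k'}) ζ_{γ−d}` — hence (§4) for the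
  pair symbol `hypPairSymb k k' = π z_k z_{k'} + π⁻¹∂_k∂_{k'}` of `JunctionHyperbolicFockMatrix`: `hypPairSymb_zeta`, and its
  SYMMETRY on the polynomial core `inner_fockToL2_hypPairSymb`;
* §2 the Hermite-coefficient functionals `T_β := piCoeffCLM β` of `SchwartzTensorSchur` ARE the `L²` pairings `⟪h_β, ·⟫_{L²} ∘ toL2`
  (`piCoeffCLM_eq_innerSL_comp_toL2`, `piCoeffCLM_eq_inner`; on Fock polynomials `piCoeffCLM_binvPi : T_β(B⁻¹F) = ⟪ζ_β, F⟫_𝓕`),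
  orthonormality `inner_fockToL2_zeta_zeta`, and the density principle `clm_real_eq_of_eq_on_binvPi`
  (two continuous real-linear maps on `𝓢` agreeing on all `B⁻¹F` are equal — the Hermite expansion converges in `𝓢`,
  tree `hasSum_hermiteCoeff_smul_hermitePi`);
* §3 THE LADDER-DIAGONAL ENTRIES OF A LINEAR SUBSTITUTION: for a matrix `M` with `M_{kk'} = 0`,
  `⟪ζ_{nd}, ζ_{nd}(Mz)⟫_𝓕 = (M_{kk} M_{k'k'})^n` (`inner_fockToL2_zeta_linSubst_zeta_nsmul`) — peel the `z`'s into derivatives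
  (`inner_fockToL2_X_pow_mul : ⟪z_i^m F, G⟫ = π^{-m}⟪F, ∂_i^m G⟫`), `∂_{k'}` kills the `k`-row (`pderiv_linRow`), and `∂_i^m` of the
  `n`-th power of a polynomial with constant `∂_i` is explicit (`iterate_pderiv_pow`); normalisation `hcoef_nsmul_pair :
  hcoef (nd) = π^n/n!`.

BOUNDARY.  Everything here is PROVED ([folklore] polynomial algebra + the landed Fock-model files); no statement of print is
used as a hypothesis and no record (`def … : Prop`) is introduced.  The `[cite:]` tags point to the places in Folland 1989
whose statements are being re-derived, for the reader; they are not records.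

## Main results
* `Literature.Analysis.SegalBargmann.pi_smul_X_mul_X_mul_zeta`, `inv_pi_smul_pderiv_pderiv_zeta`, `pi_mul_hcoef`;
* `Literature.RepresentationTheory.KonnoKonno2007.RealDualPair.hypPairSymb_zeta`, `inner_fockToL2_hypPairSymb`;
* `Literature.Analysis.SegalBargmann.piCoeffCLM_eq_innerSL_comp_toL2`, `piCoeffCLM_eq_inner`, `piCoeffCLM_binvPi`,
  `inner_fockToL2_zeta_zeta`,
  `clm_real_eq_of_eq_on_binvPi`;
* `Literature.Analysis.SegalBargmann.iterate_pderiv_pow`, `inner_fockToL2_X_pow_mul`, `hcoef_nsmul_pair`,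
  `inner_fockToL2_zeta_linSubst_zeta_nsmul`.

## References
* [Folland1989] G. B. Folland, *Harmonic Analysis in Phase Space*, Annals of Math. Studies 122 (1989), §1.6 (1.63), (1.68),
  §1.7 (1.77), (1.82), Prop. (4.39).
* [KonnoKonno2007] K. Konno, T. Konno, Kyushu J. Math. 61 (2007) §2, §3.1 (doi:10.2206/kyushujm.61.35) — the junction whose
  hyperbolic family this serves; conventions only, nothing cited as a fact.
-/

set_option autoImplicit false

noncomputable section

open Matrix Complex MeasureTheory Filter MvPolynomial
open scoped Topology Real InnerProductSpace ComplexConjugate BigOperators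

namespace Literature.Analysis.SegalBargmann

local notation "SR" σ => SchwartzMap (σ → ℝ) ℂ
local notation "L2R" σ => Lp ℂ 2 (volume : Measure (σ → ℝ))

/-! ## §1  The two-mode ladder on the normalised monomials -/

section Ladder

variable {σ : Type*} [Fintype σ] [DecidableEq σ]

omit [Fintype σ] in
/-- `∂_k ∂_{k'} z^γ = γ_{k'} γ_k z^{γ − e_k − e_{k'}}` for `k ≠ k'`. [folklore] -/
theorem pderiv_pderiv_monomial_one {k k' : σ} (hkk : k ≠ k') (γ : σ →₀ ℕ) :
    pderiv k (pderiv k' (monomial γ (1 : ℂ))) =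
      ((γ k' * γ k : ℕ) : ℂ) • monomial (γ - (Finsupp.single k 1 + Finsupp.single k' 1)) 1 := by
  rw [pderiv_monomial, pderiv_monomial, one_mul, Finsupp.tsub_apply, Finsupp.single_apply, if_neg (Ne.symm hkk),
    Nat.sub_zero, smul_monomial, smul_eq_mul, mul_one, Nat.cast_mul, add_comm, ← tsub_tsub]

omit [Fintype σ] [DecidableEq σ] in
/-- `z_k z_{k'} z^γ = z^{γ + e_k + e_{k'}}`. [folklore] -/
theorem X_mul_X_mul_monomial_one (k k' : σ) (γ : σ →₀ ℕ) :
    X k * (X k' * monomial γ (1 : ℂ)) = monomial (γ + (Finsupp.single k 1 + Finsupp.single k' 1)) 1 := by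
  rw [X_mul_monomial_one, X_mul_monomial_one, add_assoc, add_comm (Finsupp.single k' 1)]

/-- two steps of `hcoef_step`: `π · hcoef γ = √((γ_k+1)(γ_{k'}+1)) · hcoef (γ + e_k + e_{k'})` (`k ≠ k'`). [folklore] -/
theorem pi_mul_hcoef {k k' : σ} (hkk : k ≠ k') (γ : σ →₀ ℕ) :
    π * hcoef γ = Real.sqrt ((γ k + 1) * (γ k' + 1)) * hcoef (γ + (Finsupp.single k 1 + Finsupp.single k' 1)) := by
  have e1 := hcoef_step γ k
  have e2 := hcoef_step (γ + Finsupp.single k 1) k'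
  rw [Finsupp.add_apply, Finsupp.single_apply, if_neg hkk, add_zero, add_assoc] at e2
  have hπ := Real.pi_pos
  have ha : (0 : ℝ) ≤ γ k + 1 := by positivity
  have hb : (0 : ℝ) ≤ γ k' + 1 := by positivity
  have hsq : Real.sqrt ((γ k + 1) / π) * Real.sqrt ((γ k' + 1) / π) * π = Real.sqrt ((γ k + 1) * (γ k' + 1)) := by
    rw [Real.sqrt_mul ha, Real.sqrt_div ha π, Real.sqrt_div hb π, div_mul_div_comm, Real.mul_self_sqrt hπ.le,
      div_mul_cancel₀ _ hπ.ne']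
  calc π * hcoef γ = (Real.sqrt ((γ k + 1) / π) * Real.sqrt ((γ k' + 1) / π) * π) *
        hcoef (γ + (Finsupp.single k 1 + Finsupp.single k' 1)) := by rw [e1, e2]; ring
    _ = _ := by rw [hsq]

/-- **raising**: `π z_k z_{k'} ζ_γ = √((γ_k+1)(γ_{k'}+1)) ζ_{γ + e_k + e_{k'}}` (`k ≠ k'`). [cite: Folland1989, (1.82)] -/
theorem pi_smul_X_mul_X_mul_zeta {k k' : σ} (hkk : k ≠ k') (γ : σ →₀ ℕ) :
    (π : ℂ) • (X k * (X k' * zeta γ)) =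
      ((Real.sqrt ((γ k + 1) * (γ k' + 1)) : ℝ) : ℂ) • zeta (γ + (Finsupp.single k 1 + Finsupp.single k' 1)) := by
  rw [zeta, zeta, mul_smul_comm, mul_smul_comm, X_mul_X_mul_monomial_one, smul_smul, smul_smul, ← Complex.ofReal_mul,
    ← Complex.ofReal_mul, pi_mul_hcoef hkk]

/-- **lowering**: `π⁻¹ ∂_k ∂_{k'} ζ_γ = √(γ_k γ_{k'}) ζ_{γ − e_k − e_{k'}}` (`k ≠ k'`; both sides vanish unless
`γ_k, γ_{k'} ≥ 1`). [cite: Folland1989, (1.82)] -/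
theorem inv_pi_smul_pderiv_pderiv_zeta {k k' : σ} (hkk : k ≠ k') (γ : σ →₀ ℕ) :
    (π : ℂ)⁻¹ • pderiv k (pderiv k' (zeta γ)) =
      ((Real.sqrt (γ k * γ k') : ℝ) : ℂ) • zeta (γ - (Finsupp.single k 1 + Finsupp.single k' 1)) := by
  rw [zeta, Derivation.map_smul, Derivation.map_smul, pderiv_pderiv_monomial_one hkk, zeta, smul_smul, smul_smul,
    smul_smul]
  congr 1
  by_cases h0 : γ k' * γ k = 0
  · rw [h0, Nat.cast_zero, mul_zero, mul_comm (γ k : ℝ), ← Nat.cast_mul, h0, Nat.cast_zero,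
      Real.sqrt_zero, Complex.ofReal_zero, zero_mul]
  · have hk' : 1 ≤ γ k' := Nat.one_le_iff_ne_zero.mpr fun h => h0 (by rw [h, zero_mul])
    have hk : 1 ≤ γ k := Nat.one_le_iff_ne_zero.mpr fun h => h0 (by rw [h, mul_zero])
    set δ := γ - (Finsupp.single k 1 + Finsupp.single k' 1) with hδ
    have hγ : γ = δ + (Finsupp.single k 1 + Finsupp.single k' 1) := by
      rw [hδ, tsub_add_cancel_of_le]
      intro j
      rw [Finsupp.add_apply, Finsupp.single_apply, Finsupp.single_apply]
      split_ifs with h1 h2 h2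
      · exact absurd (h1.trans h2.symm) hkk
      · subst h1; simpa using hk
      · subst h2; simpa using hk'
      · simp
    have hstep := pi_mul_hcoef hkk δ
    rw [← hγ] at hstep
    have hδk : (δ k : ℝ) + 1 = γ k := by
      conv_rhs => rw [hγ]
      rw [Finsupp.add_apply, Finsupp.add_apply, Finsupp.single_eq_same, Finsupp.single_apply,
        if_neg (Ne.symm hkk)]
      push_cast; ring
    have hδk' : (δ k' : ℝ) + 1 = γ k' := by
      conv_rhs => rw [hγ]
      rw [Finsupp.add_apply, Finsupp.add_apply, Finsupp.single_eq_same, Finsupp.single_apply, if_neg hkk]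
      push_cast; ring
    rw [hδk, hδk'] at hstep
    -- `hstep : π * hcoef δ = √(γ_k γ_{k'}) * hcoef γ`
    have hπ : (π : ℂ) ≠ 0 := Complex.ofReal_ne_zero.mpr Real.pi_ne_zero
    have hs : Real.sqrt (γ k * γ k') * Real.sqrt (γ k * γ k') = γ k * γ k' :=
      Real.mul_self_sqrt (by positivity)
    have hsC : ((Real.sqrt (γ k * γ k') : ℝ) : ℂ) * ((Real.sqrt (γ k * γ k') : ℝ) : ℂ) = (γ k : ℂ) * (γ k' : ℂ) := by
      exact_mod_cast hs
    have hstepC : (π : ℂ) * ((hcoef δ : ℝ) : ℂ) = ((Real.sqrt (γ k * γ k') : ℝ) : ℂ) * ((hcoef γ : ℝ) : ℂ) := by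
      exact_mod_cast congrArg (fun x : ℝ => (x : ℂ)) hstep
    rw [mul_assoc, inv_mul_eq_iff_eq_mul₀ hπ]
    push_cast
    linear_combination (-((Real.sqrt (γ k * γ k') : ℝ) : ℂ)) * hstepC - ((hcoef γ : ℝ) : ℂ) * hsC
end Ladder

/-! ## §2  The Hermite-coefficient functionals `T_β = piCoeffCLM β = ⟪h_β, ·⟫` and density of the Fock polynomials in `𝓢` -/

section Functionals

variable {σ : Type*} [Fintype σ] [DecidableEq σ]

attribute [local instance 10000] InnerProductSpace.toInner

/-- `⟪ζ_α, ζ_β⟫_𝓕 = δ_{αβ}`. [cite: Folland1989, Thm (1.63)] -/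
theorem inner_fockToL2_zeta_zeta (α β : σ →₀ ℕ) :
    ⟪fockToL2 (zeta α), fockToL2 (zeta β)⟫_ℂ = if α = β then 1 else 0 := by
  rw [fockToL2_zeta, fockToL2_zeta, ← fockBasis_apply, ← fockBasis_apply,
    orthonormal_iff_ite.mp (fockBasis (σ := σ)).orthonormal]

/-- **the Hermite-coefficient functional of `SchwartzTensorSchur` is the `L²` pairing with the Hermite function**:
`piCoeffCLM β = ⟪h_β, ·⟫_{L²} ∘ toL2` — two continuous linear forms on `𝓢(ℝ^σ, ℂ)` agreeing on every `h_δ`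
(`clm_eq_of_eq_on_hermitePi`). [cite: Folland1989, §1.7] -/
theorem piCoeffCLM_eq_innerSL_comp_toL2 (β : σ →₀ ℕ) :
    piCoeffCLM β = (innerSL ℂ (hermiteL2 β : L2R σ)).comp (toL2 : (SR σ) →L[ℂ] L2R σ) :=
  clm_eq_of_eq_on_hermitePi fun δ => by
    rw [piCoeffCLM_apply, piCoeff_hermitePi, ContinuousLinearMap.comp_apply]
    change _ = ⟪(hermiteL2 β : L2R σ), toL2 (hermitePi δ : SR σ)⟫_ℂ
    rw [← toL2_hermitePi, ← binvPi_zeta, ← binvPi_zeta, toL2_binvPi, toL2_binvPi, LinearIsometryEquiv.inner_map_map,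
      inner_fockToL2_zeta_zeta]

/-- pointwise form: `c_β(f) = ⟪h_β, f⟫_{L²}` for every `f ∈ 𝓢(ℝ^σ, ℂ)`. [cite: Folland1989, §1.7] -/
theorem piCoeffCLM_eq_inner (β : σ →₀ ℕ) (f : SR σ) : piCoeffCLM β f = ⟪(hermiteL2 β : L2R σ), toL2 f⟫_ℂ := by
  rw [piCoeffCLM_eq_innerSL_comp_toL2]; rfl

/-- on the image of the Fock polynomials: `c_β(B⁻¹F) = ⟪ζ_β, F⟫_𝓕`. [cite: Folland1989, §1.7] -/
theorem piCoeffCLM_binvPi (β : σ →₀ ℕ) (F : MvPolynomial σ ℂ) :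
    piCoeffCLM β (binvPi F) = ⟪fockToL2 (zeta β), fockToL2 F⟫_ℂ := by
  rw [piCoeffCLM_eq_inner, ← toL2_hermitePi, ← binvPi_zeta, toL2_binvPi, toL2_binvPi, LinearIsometryEquiv.inner_map_map]

/-- **density, real-linear form**: continuous REAL-linear maps on `𝓢(ℝ^σ, ℂ)` agreeing on every Fock polynomial vector
`B⁻¹F` are equal (the Hermite expansion converges in `𝓢`). [cite: Folland1989, §1.7] -/
theorem clm_real_eq_of_eq_on_binvPi {Y : Type*} [AddCommMonoid Y] [Module ℝ Y] [TopologicalSpace Y] [T2Space Y]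
    {S T : (SR σ) →L[ℝ] Y} (h : ∀ F : MvPolynomial σ ℂ, S (binvPi F) = T (binvPi F)) : S = T := by
  refine ContinuousLinearMap.ext fun f => ?_
  have hf := hasSum_hermiteCoeff_smul_hermitePi f
  have hS := hf.mapL S
  have hT := hf.mapL T
  simp only [← binvPi_zeta, ← binvPi_smul] at hS hT
  simp only [h] at hS
  exact hS.unique hT

end Functionals

/-! ## §3  The ladder-diagonal entries of a linear substitution `F ↦ F(Mz)` with `M_{kk'} = 0` -/

section KernelPeel

variable {σ : Type*} [Fintype σ] [DecidableEq σ]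

attribute [local instance 10000] InnerProductSpace.toInner

omit [Fintype σ] [DecidableEq σ] in
/-- iterated `∂_i` of a power of a polynomial with CONSTANT `∂_i`-derivative:
`∂_i^m (A^n) = n(n−1)⋯(n−m+1) · a^m · A^{n−m}` (`m ≤ n`, `∂_i A = a`). [folklore] -/
theorem iterate_pderiv_pow {i : σ} {A : MvPolynomial σ ℂ} {a : ℂ} (hA : pderiv i A = C a) (n : ℕ) :
    ∀ m : ℕ, m ≤ n → (pderiv i)^[m] (A ^ n) = C ((n.descFactorial m : ℂ) * a ^ m) * A ^ (n - m)
  | 0, _ => by simp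
  | m + 1, hmn => by
    rw [Function.iterate_succ_apply', iterate_pderiv_pow hA n m (Nat.le_of_succ_le hmn), pderiv_C_mul, pderiv_pow, hA,
      Nat.descFactorial_succ, Nat.sub_add_eq]
    have hnm : ((n - m : ℕ) : MvPolynomial σ ℂ) = C ((n - m : ℕ) : ℂ) := (map_natCast C (n - m)).symm
    rw [hnm]
    simp only [map_mul, map_pow, Nat.cast_mul, map_natCast]
    ring

omit [Fintype σ] [DecidableEq σ] in
/-- `∂_i^m (C c · F) = C c · ∂_i^m F`. [folklore] -/
theorem iterate_pderiv_C_mul (i : σ) (c : ℂ) (F : MvPolynomial σ ℂ) (m : ℕ) :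
    (pderiv i)^[m] (C c * F) = C c * (pderiv i)^[m] F := by
  induction m with
  | zero => rfl
  | succ m ih => rw [Function.iterate_succ_apply', Function.iterate_succ_apply', ih, pderiv_C_mul]

omit [DecidableEq σ] in
/-- **peeling coordinates into derivatives**: `⟪z_i^m F, G⟫_𝓕 = π^{−m} ⟪F, ∂_i^m G⟫_𝓕`. [cite: Folland1989, Thm (1.63)] -/
theorem inner_fockToL2_X_pow_mul (i : σ) (m : ℕ) (F G : MvPolynomial σ ℂ) :
    ⟪fockToL2 (X i ^ m * F), fockToL2 G⟫_ℂ = ((π : ℂ)⁻¹) ^ m * ⟪fockToL2 F, fockToL2 ((pderiv i)^[m] G)⟫_ℂ := by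
  induction m generalizing F with
  | zero => simp
  | succ m ih =>
    rw [pow_succ, mul_assoc, ih (X i * F), inner_fockToL2_X_mul, Function.iterate_succ_apply', pow_succ]
    ring

omit [Fintype σ] [DecidableEq σ] in
/-- `∂_j (Σ_l M_{il} z_l) = M_{ij}`. [folklore] -/
theorem pderiv_linRow [Fintype σ] (M : Matrix σ σ ℂ) (i j : σ) :
    pderiv j (∑ l, C (M i l) * X l : MvPolynomial σ ℂ) = C (M i j) := by
  rw [map_sum, Finset.sum_eq_single j]
  · rw [pderiv_C_mul, pderiv_X_self, mul_one]
  · intro l _ hl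
    rw [pderiv_C_mul, pderiv_X_of_ne hl, mul_zero]
  · intro h
    exact absurd (Finset.mem_univ j) h

omit [Fintype σ] in
/-- `(n (e_k + e_{k'}))_k = n`. [folklore] -/
theorem nsmul_pair_apply_left {k k' : σ} (hkk : k ≠ k') (n : ℕ) :
    (n • (Finsupp.single k 1 + Finsupp.single k' 1) : σ →₀ ℕ) k = n := by
  rw [Finsupp.smul_apply, Finsupp.add_apply, Finsupp.single_eq_same, Finsupp.single_apply, if_neg (Ne.symm hkk),
    add_zero, smul_eq_mul, mul_one]

omit [Fintype σ] in
/-- `(n (e_k + e_{k'}))_{k'} = n`. [folklore] -/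
theorem nsmul_pair_apply_right {k k' : σ} (hkk : k ≠ k') (n : ℕ) :
    (n • (Finsupp.single k 1 + Finsupp.single k' 1) : σ →₀ ℕ) k' = n := by
  rw [Finsupp.smul_apply, Finsupp.add_apply, Finsupp.single_eq_same, Finsupp.single_apply, if_neg hkk, zero_add,
    smul_eq_mul, mul_one]

omit [DecidableEq σ] in
/-- `hcoef 0 = 1`. [folklore] -/
theorem hcoef_zero : hcoef (0 : σ →₀ ℕ) = 1 := by
  simp [hcoef, mdeg, mfact]

omit [DecidableEq σ] in
/-- `ζ_0 = 1`. [folklore] -/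
theorem zeta_zero : zeta (0 : σ →₀ ℕ) = 1 := by
  rw [zeta, hcoef_zero, Complex.ofReal_one, one_smul, ← C_apply, C_1]

/-- on the two-mode ladder the Hermite normalisation is `hcoef (n d) = π^n / n!`. [folklore] -/
theorem hcoef_nsmul_pair {k k' : σ} (hkk : k ≠ k') (n : ℕ) :
    hcoef (n • (Finsupp.single k 1 + Finsupp.single k' 1)) = π ^ n / n.factorial := by
  induction n with
  | zero => rw [zero_smul, hcoef_zero, pow_zero, Nat.factorial_zero, Nat.cast_one, div_one]
  | succ n ih =>
    have h := pi_mul_hcoef hkk (n • (Finsupp.single k 1 + Finsupp.single k' 1))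
    rw [nsmul_pair_apply_left hkk, nsmul_pair_apply_right hkk, Real.sqrt_mul_self (by positivity), ih,
      ← succ_nsmul] at h
    have hn : ((n : ℝ) + 1) ≠ 0 := by positivity
    have hf : ((n.factorial : ℕ) : ℝ) ≠ 0 := by positivity
    rw [Nat.factorial_succ, Nat.cast_mul, pow_succ]
    push_cast
    field_simp
    field_simp at h
    linarith

/-- **(K-b), Fock form**: for a matrix `M` with `M_{kk'} = 0` the ladder-diagonal entry of the substitution
`F ↦ F(Mz)` is `⟪ζ_{n d}, ζ_{n d}(Mz)⟫_𝓕 = (M_{kk} M_{k'k'})^n`, `d = e_k + e_{k'}` — peel the `z`'s into derivatives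
(`⟪z_i F, G⟫ = π⁻¹⟪F, ∂_i G⟫`), `∂_{k'}` kills the `k`-row, and `∂^n` of the `n`-th power of a linear form is `n!` times
the `n`-th power of its coefficient. [cite: Folland1989, Prop (4.39), Thm (1.63)] -/
theorem inner_fockToL2_zeta_linSubst_zeta_nsmul {k k' : σ} (hkk : k ≠ k') (M : Matrix σ σ ℂ) (hM : M k k' = 0)
    (n : ℕ) :
    ⟪fockToL2 (zeta (n • (Finsupp.single k 1 + Finsupp.single k' 1))),
      fockToL2 (linSubst M (zeta (n • (Finsupp.single k 1 + Finsupp.single k' 1))))⟫_ℂ = (M k k * M k' k') ^ n := by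
  have hmon : monomial (n • (Finsupp.single k 1 + Finsupp.single k' 1)) (1 : ℂ) =
      (X k' ^ n * (X k ^ n * 1) : MvPolynomial σ ℂ) := by
    rw [mul_one, smul_add, Finsupp.smul_single, Finsupp.smul_single, smul_eq_mul, mul_one, add_comm,
      X_pow_eq_monomial, X_pow_eq_monomial, monomial_mul, mul_one]
  set A : MvPolynomial σ ℂ := ∑ l, C (M k l) * X l with hAdef
  set B : MvPolynomial σ ℂ := ∑ l, C (M k' l) * X l with hBdef
  have hA' : pderiv k' A = 0 := by rw [hAdef, pderiv_linRow, hM, C_0]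
  have hA : pderiv k A = C (M k k) := by rw [hAdef, pderiv_linRow]
  have hB : pderiv k' B = C (M k' k') := by rw [hBdef, pderiv_linRow]
  have hsub : linSubst M (X k' ^ n * (X k ^ n * 1)) = B ^ n * A ^ n := by
    rw [mul_one, map_mul, map_pow, map_pow, linSubst_X, linSubst_X]
  have hBA : ∀ m, (pderiv k')^[m] (B ^ n * A ^ n) = (pderiv k')^[m] (B ^ n) * A ^ n := by
    intro m
    induction m with
    | zero => rfl
    | succ m ih =>
      rw [Function.iterate_succ_apply', Function.iterate_succ_apply', ih, pderiv_mul, pderiv_pow, hA', mul_zero,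
        mul_zero, add_zero]
  have h1 : (pderiv k')^[n] (B ^ n) = C ((n.factorial : ℂ) * M k' k' ^ n) := by
    rw [iterate_pderiv_pow hB n n le_rfl, Nat.descFactorial_self, Nat.sub_self, pow_zero, mul_one]
  have h2 : (pderiv k)^[n] (A ^ n) = C ((n.factorial : ℂ) * M k k ^ n) := by
    rw [iterate_pderiv_pow hA n n le_rfl, Nat.descFactorial_self, Nat.sub_self, pow_zero, mul_one]
  have h00 : ⟪fockToL2 (1 : MvPolynomial σ ℂ), fockToL2 (1 : MvPolynomial σ ℂ)⟫_ℂ = 1 := by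
    rw [← zeta_zero, inner_fockToL2_zeta_zeta, if_pos rfl]
  rw [zeta, map_smul, map_smul, map_smul, inner_smul_left (E := FockL2 σ), inner_smul_right (E := FockL2 σ),
    Complex.conj_ofReal, hmon, hsub, inner_fockToL2_X_pow_mul, hBA, h1, inner_fockToL2_X_pow_mul,
    iterate_pderiv_C_mul, h2, ← map_mul, MvPolynomial.C_eq_smul_one, map_smul, inner_smul_right (E := FockL2 σ), h00,
    hcoef_nsmul_pair hkk]
  have hπ : (π : ℂ) ≠ 0 := Complex.ofReal_ne_zero.mpr Real.pi_ne_zero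
  have hf : ((n.factorial : ℕ) : ℂ) ≠ 0 := Nat.cast_ne_zero.mpr (Nat.factorial_ne_zero n)
  have hππ : (π : ℂ) ^ n * ((π : ℂ)⁻¹) ^ n = 1 := by rw [← mul_pow, mul_inv_cancel₀ hπ, one_pow]
  push_cast
  field_simp
  linear_combination (M k' k' ^ n * M k k ^ n * ((π : ℂ) ^ n * ((π : ℂ)⁻¹) ^ n + 1)) * hππ

end KernelPeel

end Literature.Analysis.SegalBargmann

/-! ## §4  The pair symbol `hypPairSymb k k' = π z_k z_{k'} + π⁻¹∂_k∂_{k'}` (`JunctionHyperbolicFockMatrix`): ladder and symmetry -/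

namespace Literature.RepresentationTheory.KonnoKonno2007

namespace RealDualPair

open Literature.Analysis.SegalBargmann

local notation "SR" σ => SchwartzMap (σ → ℝ) ℂ
local notation "L2R" σ => Lp ℂ 2 (volume : Measure (σ → ℝ))

section PairSymbol

variable {σ : Type*} [Fintype σ] [DecidableEq σ]

/-- **THE LADDER of the pair symbol**: `(π z_k z_{k'} + π⁻¹ ∂_k ∂_{k'}) ζ_γ = √((γ_k+1)(γ_{k'}+1)) ζ_{γ+d} +
√(γ_k γ_{k'}) ζ_{γ−d}`, `d = e_k + e_{k'}`. [cite: Folland1989, (1.82)] -/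
theorem hypPairSymb_zeta {k k' : σ} (hkk : k ≠ k') (γ : σ →₀ ℕ) :
    hypPairSymb k k' (zeta γ) =
      ((Real.sqrt ((γ k + 1) * (γ k' + 1)) : ℝ) : ℂ) • zeta (γ + (Finsupp.single k 1 + Finsupp.single k' 1)) +
        ((Real.sqrt (γ k * γ k') : ℝ) : ℂ) • zeta (γ - (Finsupp.single k 1 + Finsupp.single k' 1)) := by
  rw [hypPairSymb, pi_smul_X_mul_X_mul_zeta hkk, inv_pi_smul_pderiv_pderiv_zeta hkk]

attribute [local instance 10000] InnerProductSpace.toInner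

/-- `⟪G, (π z_k z_{k'} + π⁻¹ ∂_k∂_{k'}) F⟫_𝓕 = ⟪(π z_k z_{k'} + π⁻¹ ∂_k∂_{k'}) G, F⟫_𝓕` on polynomial vectors
(`z_j` and `π⁻¹∂_j` are mutually adjoint on the core). [cite: Folland1989, (1.77)] -/
theorem inner_fockToL2_hypPairSymb (k k' : σ) (G F : MvPolynomial σ ℂ) :
    ⟪fockToL2 G, fockToL2 (hypPairSymb k k' F)⟫_ℂ = ⟪fockToL2 (hypPairSymb k k' G), fockToL2 F⟫_ℂ := by
  have hπ : (π : ℂ) ≠ 0 := Complex.ofReal_ne_zero.mpr Real.pi_ne_zero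
  -- `⟪A, z_j B⟫ = π⁻¹ ⟪∂_j A, B⟫` and `⟪A, ∂_j B⟫ = π ⟪z_j A, B⟫`
  have hX : ∀ (j : σ) (A B : MvPolynomial σ ℂ),
      ⟪fockToL2 A, fockToL2 (X j * B)⟫_ℂ = (π : ℂ)⁻¹ * ⟪fockToL2 (pderiv j A), fockToL2 B⟫_ℂ := fun j A B => by
    rw [inner_fockToL2_pderiv, ← mul_assoc, inv_mul_cancel₀ hπ, one_mul]
  have hD : ∀ (j : σ) (A B : MvPolynomial σ ℂ),
      ⟪fockToL2 A, fockToL2 (pderiv j B)⟫_ℂ = (π : ℂ) * ⟪fockToL2 (X j * A), fockToL2 B⟫_ℂ := fun j A B => by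
    rw [inner_fockToL2_X_mul, ← mul_assoc, mul_inv_cancel₀ hπ, one_mul]
  rw [hypPairSymb, hypPairSymb, map_add, map_add, inner_add_right, inner_add_left, map_smul, map_smul, map_smul,
    map_smul, inner_smul_right (E := FockL2 σ), inner_smul_right (E := FockL2 σ), inner_smul_left (E := FockL2 σ),
    inner_smul_left (E := FockL2 σ), hX, hX, hD, hD,
    pderiv_pderiv_comm k' k G, mul_comm (X k') (X k * G), mul_assoc (X k) G (X k'), mul_comm G (X k'),
    Complex.conj_ofReal, ← Complex.ofReal_inv, Complex.conj_ofReal, Complex.ofReal_inv]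
  field_simp
  ring

end PairSymbol

end RealDualPair

end Literature.RepresentationTheory.KonnoKonno2007
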